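import Summits.BirchSwinnertonDyer.BirchSwinnertonDyer.Theorems.AlignedTransportAtTwoMainConjectureTransportAlignedAtTwoBuzzardKTwo
import Summits.BirchSwinnertonDyer.BirchSwinnertonDyer.Theorems.AlignedTransportAtTwoMainConjectureTransportAlignedAtTwoTrichotomyAlgebra
import HarnessLib

/-!
# Crux C1 `MainConjectureTransportAlignedAtTwo` (stmt-BirchSwinnertonDyer-22296), line `birth`: (K4) «PLUS MULTIPLICITY AT MOST FOUR MOD 2 ON THE
# PERIOD HOMOLOGY» for an `S₃`-curve with `Δ ∉ ℚ₂²` and NO SIGN CONDITION — the Buzzard input on the `Δ > 0` residual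
# (width seat att-p4 g11; `--supports 22296`)

THEOREMS ONLY (no `def`, no `sorry`, no new named fact). BSD is not proved by this; C1 is not closed by this.

The lead's `…BuzzardKTwo.kTwo_of_dvd_S3` (att-p1 g9) proves (K2) «`x, y ∈ Λ ∖ K ⇒ x − y ∈ K`» for `S₃`-curves with `Δ < 0`, `Δ ∉ ℚ₂²`: B4
(four cosets of `𝔪₀Λ` in `Λ = H₁(X₀(L); ℤ)`, from Buzzard 2000 Prop. 2.4 + Hecke self-duality) AND B5 (complex conjugation non-trivial on `Λ/𝔪₀Λ`,
from the RHOMBIC Néron lattice). On the `Δ > 0` half B5 is false (rectangular lattice) but B4 survives. This file isolates B4 at the flexible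
level with NO sign hypothesis:

* §1 `fourCosets_of_dvd_S3` — for `W/ℚ` globally minimal without rational `2`-torsion abscissa and with `∀ s : ℚ_[2], s² ≠ Δ(W)` (OFF the
  Kilford stratum), newform `f`, `S ≠ ∅`, odd `L` with `N·∏ℓ² ∣ L`, `primes(L) ⊆ S`, good reduction off `2L`: every additive `K ⊇ 2Λ,
  (T_q^∨ − a_q(W))Λ, U_ℓ^∨Λ` satisfies `Λ ⊆ K ∪ (v₁ + K) ∪ (v₂ + K) ∪ (v₁ + v₂ + K)` for some `v₁, v₂ ∈ Λ` (from {SD, Bz}; the properness of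
  `𝔪₀` is read off the depleted eigenform — every element of `𝔪₀` acts on it by an EVEN integer, `1` does not — instead of off B5);
* §2 `index_addSubgroupOf_le_four` (bookkeeping) and **`trichotomy_of_dvd_S3`** — with `…TrichotomyAlgebra.eq_zero_or_eq_or_eq_or_eq_add`:
  for additive `f, g, h : Λ → ℤ/2` killing `K ∩ Λ`, `f, g` non-zero and distinct, `h ∈ {0, f, g, f + g}`. Intended use (crux workfile
  `DELTA-POS-RESIDUAL-att-p4-g11.md` §5): `f, g` = even/odd-branch depleted period functionals of `W₁`, `h` = a branch functional of `W₂`, on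
  aligned NON-twist good-ordinary `S₃` pairs with `Δ > 0` off the stratum ⇒ «`λ⁺`-law ∨ cross-law ∨ sum-law», Galois-free.

References: Buzzard, MRL 7 (2000) Prop. 2.4 [Buzzard2000LevelLoweringModTwo]; Darmon–Diamond–Taylor §1.6 Lemma 1.38, §4.5 [DarmonDiamondTaylor1995];
Cremona, *Algorithms* (1997) §2.10 [CremonaAlgorithms1997].
-/

noncomputable section

-- justification: the `Summit.BirchSwinnertonDyer.BirchSwinnertonDyer.…` path repeats a component (route-file convention)
set_option linter.dupNamespace false
set_option autoImplicit false

open scoped MatrixGroups ComplexConjugate ModularForm NumberField Pointwise Classical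
open CongruenceSubgroup Complex WeierstrassCurve IsDedekindDomain Polynomial Field Matrix Literature.NumberTheory.GaloisRepresentations
open Literature.NumberTheory.EllipticCurves Literature.NumberTheory.EllipticCurves.ModularForms
open Literature.NumberTheory.EllipticCurves.Greenberg1999
open Literature.NumberTheory.EllipticCurves.Rank1Residual Rat.HeightOneSpectrum
open Summit.BirchSwinnertonDyer.BirchSwinnertonDyer.Theorems.ThetaLayerLambdaCongruenceAtTwo
open Summit.BirchSwinnertonDyer.BirchSwinnertonDyer.Theorems.AlignedTransportAtTwoBuzzardGalois
open Summit.BirchSwinnertonDyer.BirchSwinnertonDyer.Theorems.AlignedTransportAtTwoBuzzardKTwo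
open Summit.BirchSwinnertonDyer.BirchSwinnertonDyer.Theorems.AlignedTransportAtTwoTrichotomyAlgebra

namespace Summit.BirchSwinnertonDyer.BirchSwinnertonDyer.Theorems.AlignedTransportAtTwoBuzzardKFour

/-! ## §1 Four cosets, no sign condition -/

/-- **(K4) FOUR COSETS for an `S₃`-curve with `Δ_W ∉ ℚ₂²`, from {Hecke self-duality of `J₀(L)[2]`, Buzzard 2000 Prop. 2.4}, NO SIGN CONDITION.**
`W/ℚ` globally minimal without rational `2`-torsion abscissa, `∀ s : ℚ_[2], s² ≠ Δ_W`; newform `f` of level `N`; `S ≠ ∅` finite set of primes;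
`L` odd with `N·∏_{ℓ∈S} ℓ² ∣ L`, `primes(L) ⊆ S`, good reduction at every `p ∤ 2L`. Then for every additive `K ⊇ 2Λ, (T_q^∨ − a_q(W))Λ, U_ℓ^∨Λ`
(`Λ = periodHomology L`) there are `v₁, v₂ ∈ Λ` with `∀ x ∈ Λ, x ∈ K ∨ x − v₁ ∈ K ∨ x − v₂ ∈ K ∨ x − (v₁ + v₂) ∈ K`. (Properness of the
eigen-ideal `𝔪₀`: its elements act on the depleted eigenform `g` — `a₁(g) = 1` — by even integers, so `1 ∉ 𝔪₀`; then `|𝕋/𝔪₀| = 2`, Buzzard via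
`…BuzzardGalois.finrank_torsionBySet_eq_two_of_buzzard_S3`, and bsd-wall's `exists_fourCosets_periodHomology_of_multiplicityOne`.)
[cite: Buzzard2000LevelLoweringModTwo, Prop. 2.4] [cite: DarmonDiamondTaylor1995, §1.6 Lemma 1.38 and §4.5 Thm. 4.26] -/
theorem fourCosets_of_dvd_S3
    (hSD : heckeSelfDual_torsionBy_J0) (hBz : buzzard2000_multiplicityOne_gamma0)
    (W : WeierstrassCurve ℚ) [W.IsElliptic] [W.IsGloballyMinimal] (ht : ∀ x : ℚ, ¬ HasRationalTwoTorsionX W x)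
    (hΔ₂ : ∀ s : ℚ_[2], s ^ 2 ≠ (W.Δ : ℚ_[2]))
    {N : ℕ} [NeZero N] {f : CuspForm (Gamma0 N) 2} (hf : IsNewformOf W f)
    (S : Finset ℕ) (hS : ∀ ℓ ∈ S, ℓ.Prime)
    (L : ℕ) [NeZero L] (hL : Odd L) (hNL : N * ∏ ℓ ∈ S, ℓ ^ 2 ∣ L) (hLS : ∀ p : ℕ, p.Prime → p ∣ L → p ∈ S)
    (hgood : ∀ v : HeightOneSpectrum (𝓞 ℚ), ¬ ((primesEquiv v : ℕ) ∣ 2 * L) → W.HasGoodReductionAt v)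
    (K : AddSubgroup (Module.Dual ℂ (CuspForm (Gamma0 L) 2)))
    (h2K : ∀ x ∈ periodHomology L, (2 : ℂ) • x ∈ K)
    (hTK : ∀ (q : ℕ) (hq : q.Prime), ¬ q ∣ L → ∀ x ∈ periodHomology L,
      (haveI : NeZero q := ⟨hq.ne_zero⟩; heckeT (Gamma0 L) 2 q).dualMap x - (W.LFunction q : ℂ) • x ∈ K)
    (hUK : ∀ (q : ℕ) (hq : q.Prime), q ∣ L → ∀ x ∈ periodHomology L,
      (haveI : NeZero q := ⟨hq.ne_zero⟩; heckeT (Gamma0 L) 2 q).dualMap x ∈ K) :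
    ∃ v₁ ∈ periodHomology L, ∃ v₂ ∈ periodHomology L, ∀ x ∈ periodHomology L,
      x ∈ K ∨ x - v₁ ∈ K ∨ x - v₂ ∈ K ∨ x - (v₁ + v₂) ∈ K := by
  classical
  set G : Set (HeckeRing0 L 2) := {t : HeckeRing0 L 2 | t = 2 ∨ (∃ (q : ℕ) (hq : q.Prime), ¬ q ∣ L ∧
      t = HeckeRing0.T L 2 q hq - (W.LFunction q : HeckeRing0 L 2)) ∨ (∃ (q : ℕ) (hq : q.Prime), q ∣ L ∧
      t = HeckeRing0.T L 2 q hq)} with hGdef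
  -- the depleted form at level `L`
  have hint : ∀ n : ℕ, ∃ z : ℤ, cuspCoeff f n = z := fun n ↦ ⟨W.LFunction n, hf.2 n⟩
  have hTf : ∀ (p : ℕ) (hp : p.Prime), (haveI : NeZero p := ⟨hp.ne_zero⟩; heckeT (Gamma0 N) 2 p f) = cuspCoeff f p • f :=
    fun p hp ↦ by haveI : NeZero p := ⟨hp.ne_zero⟩; exact hf.1.heckeT_eq_coeff_smul hp
  have hLS' : ∀ p : ℕ, p.Prime → p ∣ L → p ∣ N ∨ p ∈ S := fun p hp h ↦ Or.inr (hLS p hp h)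
  obtain ⟨g, hg', -, -, hg1, -, -, hgall⟩ := exists_depleted_eigenform_of_dvd f hint hf.1.2.2 hTf S hS L hNL hLS'
  have hg : ∀ n : ℕ, cuspCoeff g n = if ∃ ℓ ∈ S, ℓ ∣ n then 0 else (W.LFunction n : ℂ) := fun n ↦ by rw [hg' n, hf.2 n]
  have hSL : ∀ ℓ ∈ S, ℓ ∣ L := fun ℓ hℓ ↦ (dvd_level_of_mem (M := N) (S := S) rfl hℓ).trans hNL
  have hLiff : ∀ q : ℕ, q.Prime → (q ∣ L ↔ q ∈ S) := fun q hq ↦ ⟨hLS q hq, hSL q⟩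
  -- the eigen-ideal acts on `g` by even integers and contains `2`
  have h2 : (2 : HeckeRing0 L 2) ∈ Ideal.span G := Ideal.subset_span (Or.inl rfl)
  have hb : ∀ (q : ℕ) (hq : q.Prime), (haveI : NeZero q := ⟨hq.ne_zero⟩; heckeT (Gamma0 L) 2 q g) =
      (((if q ∈ S then 0 else W.LFunction q : ℤ)) : ℂ) • g := fun q hq ↦ by
    rw [hgall q hq, hg q]
    by_cases hqS : q ∈ S
    · rw [if_pos ⟨q, hqS, dvd_rfl⟩, if_pos hqS, Int.cast_zero]
    · rw [if_neg, if_neg hqS]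
      rintro ⟨ℓ, hℓ, hd⟩
      exact hqS (((Nat.prime_dvd_prime_iff_eq (hS ℓ hℓ) hq).mp hd) ▸ hℓ)
  have h𝔪 : ∀ t ∈ Ideal.span G, ∃ e : ℤ, HeckeRing0.toEnd L 2 t g = ((2 * e : ℤ) : ℂ) • g := by
    refine ideal_span_acts_even g (fun q ↦ if q ∈ S then 0 else W.LFunction q) hb G fun t ht ↦ ?_
    rcases ht with rfl | ⟨q, hq, hqL, rfl⟩ | ⟨q, hq, hqL, rfl⟩
    · exact Or.inl rfl
    · refine Or.inr ⟨q, hq, ?_⟩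
      rw [if_neg (fun h ↦ hqL ((hLiff q hq).mpr h))]
    · refine Or.inr ⟨q, hq, ?_⟩
      rw [if_pos ((hLiff q hq).mp hqL), Int.cast_zero, sub_zero]
  -- `𝔪₀ ≠ ⊤`: `1` acts on `g ≠ 0` by `1`, not by an even integer
  have hne : Ideal.span G ≠ ⊤ := by
    intro htop
    obtain ⟨e, he⟩ := h𝔪 1 (htop ▸ Submodule.mem_top)
    rw [map_one, Module.End.one_apply] at he
    have h1 : cuspCoeff g 1 = ((2 * e : ℤ) : ℂ) * cuspCoeff g 1 := by
      have hsm := (cuspCoeffₗ (one_mem_strictPeriods_coe_gamma0 L) 1).map_smul ((2 * e : ℤ) : ℂ) g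
      rw [cuspCoeffₗ_apply, cuspCoeffₗ_apply, smul_eq_mul, ← he] at hsm
      exact hsm
    rw [hg1, mul_one] at h1
    have h2e : (1 : ℤ) = 2 * e := by exact_mod_cast h1
    omega
  have hq := natCard_quotient_eq_two_of_ne_top (Ideal.span G) h2 (eigenIdeal_T_sub_int_mem W) hne
  haveI h𝔪max : (Ideal.span G).IsMaximal := isMaximal_of_natCard_quotient_eq_two _ hq
  have hT : ∀ (q : ℕ) (hq' : q.Prime), ¬ q ∣ L →
      HeckeRing0.T L 2 q hq' - (W.LFunction q : HeckeRing0 L 2) ∈ Ideal.span G :=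
    fun q hq' hqL ↦ Ideal.subset_span (Or.inr (Or.inl ⟨q, hq', hqL, rfl⟩))
  have hsub := finrank_torsionBySet_eq_two_of_buzzard_S3 hBz W ht hΔ₂ L hL hgood (Ideal.span G) h𝔪max h2 hq hT
  -- B4 from `hsub` and the self-duality pairing
  obtain ⟨B, hbal, hleft, -⟩ := hSD L 2
  obtain ⟨v₁, hv₁, v₂, hv₂, hcos⟩ := exists_fourCosets_periodHomology_of_multiplicityOne _ h2 hq hsub B hbal hleft
  -- `𝔪₀Λ ⊆ K`
  have hK𝔪 : ∀ z ∈ Ideal.span G • periodHomologyHecke L, z ∈ K := by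
    refine mem_of_mem_ideal_span_smul G K fun s hs z hz ↦ ?_
    rcases hs with rfl | ⟨q, hq', hqL, rfl⟩ | ⟨q, hq', hqL, rfl⟩
    · have : (2 : HeckeRing0 L 2) • z = (2 : ℂ) • z := by
        rw [show (2 : HeckeRing0 L 2) = ((2 : ℤ) : HeckeRing0 L 2) by norm_num, heckeRing0_intCast_smul, Int.cast_ofNat]
      rw [this]
      exact h2K z hz
    · rw [sub_smul, heckeRing0_T_smul, heckeRing0_intCast_smul]
      exact hTK q hq' hqL z hz
    · rw [heckeRing0_T_smul]
      exact hUK q hq' hqL z hz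
  refine ⟨v₁, hv₁, v₂, hv₂, fun x hx ↦ ?_⟩
  rcases hcos x hx with h | h | h | h
  · exact Or.inl (hK𝔪 _ h)
  · exact Or.inr (Or.inl (hK𝔪 _ h))
  · exact Or.inr (Or.inr (Or.inl (hK𝔪 _ h)))
  · exact Or.inr (Or.inr (Or.inr (hK𝔪 _ h)))

/-! ## §2 The trichotomy of mod-`2` functionals on `Λ` -/

/-- **Bookkeeping: four coset representatives ⇒ index `≤ 4` (and finite).** For `Λ ≤ A`, `K ≤ A` and `v₁, v₂ ∈ Λ` with
`Λ ⊆ K ∪ (v₁+K) ∪ (v₂+K) ∪ (v₁+v₂+K)`, the subgroup `K ∩ Λ` of `Λ` has index `≠ 0` and `≤ 4`. [folklore] -/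
theorem index_addSubgroupOf_le_four {A : Type*} [AddCommGroup A] (Λ K : AddSubgroup A) {v₁ v₂ : A} (hv₁ : v₁ ∈ Λ) (hv₂ : v₂ ∈ Λ)
    (hcos : ∀ x ∈ Λ, x ∈ K ∨ x - v₁ ∈ K ∨ x - v₂ ∈ K ∨ x - (v₁ + v₂) ∈ K) :
    (K.addSubgroupOf Λ).index ≠ 0 ∧ (K.addSubgroupOf Λ).index ≤ 4 := by
  classical
  set K' := K.addSubgroupOf Λ with hK'
  -- the four representatives, as a map `Fin 4 → Λ ⧸ K'`
  let r : Fin 4 → Λ := ![0, ⟨v₁, hv₁⟩, ⟨v₂, hv₂⟩, ⟨v₁ + v₂, add_mem hv₁ hv₂⟩]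
  have hsurj : Function.Surjective (fun i : Fin 4 ↦ (QuotientAddGroup.mk (r i) : Λ ⧸ K')) := by
    intro q
    induction q using QuotientAddGroup.induction_on with
    | H x =>
      have key : ∀ (y : Λ), (x : A) - (y : A) ∈ K → (QuotientAddGroup.mk x : Λ ⧸ K') = QuotientAddGroup.mk y := fun y hy ↦ by
        rw [QuotientAddGroup.eq_iff_sub_mem]
        exact (AddSubgroup.mem_addSubgroupOf).mpr hy
      rcases hcos x x.2 with h | h | h | h
      · exact ⟨0, (key 0 (by simpa using h)).symm⟩
      · exact ⟨1, (key ⟨v₁, hv₁⟩ h).symm⟩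
      · exact ⟨2, (key ⟨v₂, hv₂⟩ h).symm⟩
      · exact ⟨3, (key ⟨v₁ + v₂, add_mem hv₁ hv₂⟩ h).symm⟩
  haveI : Finite (Λ ⧸ K') := Finite.of_surjective _ hsurj
  refine ⟨AddSubgroup.index_ne_zero_of_finite, ?_⟩
  rw [AddSubgroup.index]
  calc Nat.card (Λ ⧸ K') ≤ Nat.card (Fin 4) := Nat.card_le_card_of_surjective _ hsurj
    _ = 4 := by simp

/-- **(K4) ⇒ THE TRICHOTOMY OF MOD-2 FUNCTIONALS** for an `S₃`-curve with `Δ_W ∉ ℚ₂²`, NO SIGN CONDITION. In the setting of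
`fourCosets_of_dvd_S3`, let `f, g, h : Λ →+ ℤ/2` be additive maps killing `K ∩ Λ`, with `f, g` non-zero and `f ≠ g`. Then
`h = 0 ∨ h = f ∨ h = g ∨ h = f + g`. (On the `Δ < 0` half the lead's (K2) says more: `f = g` is forced for non-zero `f, g` killing also the
conjugation differences; here conjugation is not used.) [cite: Buzzard2000LevelLoweringModTwo, Prop. 2.4]
[cite: DarmonDiamondTaylor1995, §1.6 Lemma 1.38 and §4.5 Thm. 4.26] -/
theorem trichotomy_of_dvd_S3
    (hSD : heckeSelfDual_torsionBy_J0) (hBz : buzzard2000_multiplicityOne_gamma0)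
    (W : WeierstrassCurve ℚ) [W.IsElliptic] [W.IsGloballyMinimal] (ht : ∀ x : ℚ, ¬ HasRationalTwoTorsionX W x)
    (hΔ₂ : ∀ s : ℚ_[2], s ^ 2 ≠ (W.Δ : ℚ_[2]))
    {N : ℕ} [NeZero N] {f₀ : CuspForm (Gamma0 N) 2} (hf₀ : IsNewformOf W f₀)
    (S : Finset ℕ) (hS : ∀ ℓ ∈ S, ℓ.Prime)
    (L : ℕ) [NeZero L] (hL : Odd L) (hNL : N * ∏ ℓ ∈ S, ℓ ^ 2 ∣ L) (hLS : ∀ p : ℕ, p.Prime → p ∣ L → p ∈ S)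
    (hgood : ∀ v : HeightOneSpectrum (𝓞 ℚ), ¬ ((primesEquiv v : ℕ) ∣ 2 * L) → W.HasGoodReductionAt v)
    (K : AddSubgroup (Module.Dual ℂ (CuspForm (Gamma0 L) 2)))
    (h2K : ∀ x ∈ periodHomology L, (2 : ℂ) • x ∈ K)
    (hTK : ∀ (q : ℕ) (hq : q.Prime), ¬ q ∣ L → ∀ x ∈ periodHomology L,
      (haveI : NeZero q := ⟨hq.ne_zero⟩; heckeT (Gamma0 L) 2 q).dualMap x - (W.LFunction q : ℂ) • x ∈ K)
    (hUK : ∀ (q : ℕ) (hq : q.Prime), q ∣ L → ∀ x ∈ periodHomology L,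
      (haveI : NeZero q := ⟨hq.ne_zero⟩; heckeT (Gamma0 L) 2 q).dualMap x ∈ K)
    (f g h : periodHomology L →+ ZMod 2)
    (hf : ∀ x : periodHomology L, (x : Module.Dual ℂ (CuspForm (Gamma0 L) 2)) ∈ K → f x = 0)
    (hg : ∀ x : periodHomology L, (x : Module.Dual ℂ (CuspForm (Gamma0 L) 2)) ∈ K → g x = 0)
    (hh : ∀ x : periodHomology L, (x : Module.Dual ℂ (CuspForm (Gamma0 L) 2)) ∈ K → h x = 0)
    (hf0 : f ≠ 0) (hg0 : g ≠ 0) (hfg : f ≠ g) :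
    h = 0 ∨ h = f ∨ h = g ∨ h = f + g := by
  obtain ⟨v₁, hv₁, v₂, hv₂, hcos⟩ := fourCosets_of_dvd_S3 hSD hBz W ht hΔ₂ hf₀ S hS L hL hNL hLS hgood K h2K hTK hUK
  obtain ⟨hfin, hle⟩ := index_addSubgroupOf_le_four (periodHomology L) K hv₁ hv₂ hcos
  refine eq_zero_or_eq_or_eq_or_eq_add (K.addSubgroupOf (periodHomology L)) hfin hle f g h ?_ ?_ ?_ hf0 hg0 hfg
  · exact fun x hx ↦ (AddMonoidHom.mem_ker).mpr (hf x ((AddSubgroup.mem_addSubgroupOf).mp hx))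
  · exact fun x hx ↦ (AddMonoidHom.mem_ker).mpr (hg x ((AddSubgroup.mem_addSubgroupOf).mp hx))
  · exact fun x hx ↦ (AddMonoidHom.mem_ker).mpr (hh x ((AddSubgroup.mem_addSubgroupOf).mp hx))

end Summit.BirchSwinnertonDyer.BirchSwinnertonDyer.Theorems.AlignedTransportAtTwoBuzzardKFour

end
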